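import Literature.Computability.Learning.LearnerBudget
import Literature.Computability.Learning.NaturalLearningSteps
import Literature.Computability.Learning.NaturalLearning
import HarnessLib

/-!
# Proof of `cikk_natural_implies_learning` (CIKK 2016, Theorem 5.1)

The discharge of the named fact `Literature.Computability.Learning.cikk_natural_implies_learning`:
a `P`-natural property of density `1/5` useful against `P/poly` yields, for every `k`, a
randomized polynomial-time membership-query learner for `SIZE[n^k]` under the uniform distribution
with subexponential coin and round budgets. The learner is `cikkLearner` / `cikkEval`
(`LearnerFP.lean`) run with `coinLen n a b ℓg` coins at the good level `ℓg = goodLvl`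
(`LearnerLevel.lean`); its analysis is `card_not_success_le` (`LearnerAnalysis.lean`) with the
parameter inequalities of `LearnerParamsIneq.lean`, and the budgets are subexponential by
`LearnerBudget.lean`.

## References

* M. Carmosino, R. Impagliazzo, V. Kabanets, A. Kolokolova, *Learning algorithms from natural
  proofs*, CCC 2016, Thm. 5.1 (with Lem. 3.4, Thm. 4.1, §5) [CarmosinoImpagliazzoKabanetsKolokolova2016].
* R. Impagliazzo, R. Jaiswal, V. Kabanets, A. Wigderson, *Uniform direct product theorems:
  simplified, optimized, and derandomized*, SIAM J. Comput. 39 (2010), Thm. 1.4 / Algorithm 1 [ImpagliazzoEtAl2010].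
-/

namespace Literature.Computability.Learning

open Literature.Computability.Complexity Literature.Computability.Complexity.DirectProduct
  Literature.Computability.MetaComplexity Literature.Computability.Cryptography _root_.Computability Finset Filter Polynomial
  Classes

/-! ### The property's decision procedure and the budgets -/

/-- The decision procedure of the property as a string function. [folklore] -/
noncomputable def propFn (R : CombinatorialProperty) : List Bool → List Bool :=
  fun y => encodeBool ((truthTableLanguage R).boolIndicator y)

/-- Constructivity: `propFn R ∈ FP`. [cite: CarmosinoImpagliazzoKabanetsKolokolova2016, Def. 2.6] -/
theorem propFn_mem_FP {R : CombinatorialProperty} (hC : IsConstructive P R) : propFn R ∈ FP :=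
  indicatorFn_mem_FP hC

/-- The coin budget. [folklore] -/
noncomputable def cikkCoins {R : CombinatorialProperty} (hU : IsUsefulAgainstPPoly R) (k₀ : ℕ) : ℕ → ℕ → ℕ → ℕ :=
  fun n a b => coinLen n a b (goodLvl hU k₀ n a b)

/-- The round budget. [folklore] -/
noncomputable def cikkRounds {R : CombinatorialProperty} (hU : IsUsefulAgainstPPoly R) (k₀ : ℕ) : ℕ → ℕ → ℕ → ℕ :=
  tBudgetOf (cikkCoins hU k₀)

/-- The coin budget is subexponential. [cite: CarmosinoImpagliazzoKabanetsKolokolova2016, Thm. 5.1] -/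
theorem isSubexpBudget_cikkCoins {R : CombinatorialProperty} (hU : IsUsefulAgainstPPoly R) (k₀ : ℕ) : IsSubexpBudget (cikkCoins hU k₀) :=
  isSubexpBudget_of_le hU k₀ 16 192 fun n a b => coinLen_le_pow n a b _

/-- The round budget is subexponential. [cite: CarmosinoImpagliazzoKabanetsKolokolova2016, Thm. 5.1] -/
theorem isSubexpBudget_cikkRounds {R : CombinatorialProperty} (hU : IsUsefulAgainstPPoly R) (k₀ : ℕ) : IsSubexpBudget (cikkRounds hU k₀) :=
  isSubexpBudget_of_le hU k₀ 64 796 fun n a b => by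
    have h := tBudgetOf_le_pow (coins := cikkCoins hU k₀) (n := n) (a := a) (b := b) (coinLen_le_pow n a b (goodLvl hU k₀ n a b)) (by omega)
    exact h.trans (le_of_eq (congrArg (fun e => 2 ^ e) (by omega)))

/-- The constant budget `1` is subexponential. [folklore] -/
theorem isSubexpBudget_one : IsSubexpBudget fun _ _ _ => 1 := by
  intro γ hγ
  refine ⟨0, fun n a b _ => ?_⟩
  push_cast
  exact Real.one_le_rpow (by norm_num) (Real.rpow_nonneg (by positivity) γ)

/-! ### Scale facts -/

/-- `1 ≤ ⌈1/ε⌉` for `0 < ε < 1`… indeed for `0 < ε`. [folklore] -/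
theorem one_le_invCeil {ε : ℝ} (hε : 0 < ε) : 1 ≤ invCeil ε := by
  rw [invCeil]; exact Nat.one_le_iff_ne_zero.2 (Nat.pos_iff_ne_zero.1 (Nat.ceil_pos.2 (by positivity)))

/-- `1/⌈1/ε⌉ ≤ ε`. [folklore] -/
theorem one_div_invCeil_le {ε : ℝ} (hε : 0 < ε) : 1 / (invCeil ε : ℝ) ≤ ε := by
  have h1 : 1 / ε ≤ (invCeil ε : ℝ) := by rw [invCeil]; exact Nat.le_ceil _
  have hpos : (0 : ℝ) < invCeil ε := lt_of_lt_of_le (by positivity) h1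
  rw [div_le_iff₀ hpos]
  calc (1 : ℝ) = 1 / ε * ε := by field_simp
    _ ≤ invCeil ε * ε := mul_le_mul_of_nonneg_right h1 hε.le
    _ = ε * invCeil ε := mul_comm _ _

/-! ### The main theorem -/

/-- `0 < prmM`. [folklore] -/
theorem prmM_pos (s ℓ : ℕ) : 0 < prmM s ℓ := by
  rw [prmM]; positivity

/-- `1 ≤ coinLen`. [folklore] -/
theorem one_le_coinLen (n a b ℓg : ℕ) : 1 ≤ coinLen n a b ℓg := by
  rw [coinLen]; have := lvlCoff_lt_succ (n := n) (a := a) (b := b) ℓg; omega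

/-- **A successful coin string yields an `ε`-good hypothesis.** [cite: CarmosinoImpagliazzoKabanetsKolokolova2016, Thm. 5.1 (proof)] -/
theorem errorProb_le_of_success {R : CombinatorialProperty} {n a b : ℕ} {f : (Fin n → Bool) → Bool} {ℓg : ℕ}
    {ε : ℝ} (hε : 0 < ε) (ha : a = invCeil ε) (rv : Fin (coinLen n a b ℓg) → Bool) (hS : Success n a b f R ℓg rv) :
    errorProb (PMF.uniformOfFintype (Fin n → Bool)) (evalHyp (cikkEval (propFn R)) 1 (gfnOut R n a b (List.ofFn rv) f)) f ≤
      ENNReal.ofReal ε := by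
  obtain ⟨ℓ, ρ, hout, herr⟩ := hS
  rw [coinsList] at hout herr
  rw [hout, evalHyp_cikkEval_candStr (dR := propFn R) R (fun y => rfl), errorProb_uniform_eq, Fintype.card_fun, Fintype.card_fin,
    Fintype.card_bool]
  have ha1 : 1 ≤ a := ha ▸ one_le_invCeil hε
  have haε : 1 / (a : ℝ) ≤ ε := ha ▸ one_div_invCeil_le hε
  have hR : ((errCount n f (hypOf R n a b (List.ofFn rv) f ℓ ρ) : ℕ) : ℝ) / 2 ^ n ≤ ε := by
    have h' : ((a * errCount n f (hypOf R n a b (List.ofFn rv) f ℓ ρ) : ℕ) : ℝ) ≤ ((2 ^ n : ℕ) : ℝ) := by exact_mod_cast herr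
    push_cast at h'
    have ha' : (0 : ℝ) < a := by exact_mod_cast ha1
    rw [div_le_iff₀ (by positivity)]
    calc (errCount n f (hypOf R n a b (List.ofFn rv) f ℓ ρ) : ℝ) ≤ 2 ^ n / a := by rw [le_div_iff₀ ha']; linarith
      _ = 1 / a * 2 ^ n := by ring
      _ ≤ ε * 2 ^ n := mul_le_mul_of_nonneg_right haε (by positivity)
  rw [errCount] at hR
  calc (((univ.filter fun x => hypOf R n a b (List.ofFn rv) f ℓ ρ x ≠ f x).card : ℕ) : ENNReal) / ((2 ^ n : ℕ) : ENNReal)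
      = ENNReal.ofReal (((univ.filter fun x => hypOf R n a b (List.ofFn rv) f ℓ ρ x ≠ f x).card : ℝ) / 2 ^ n) := by
        rw [ENNReal.ofReal_div_of_pos (by positivity), ENNReal.ofReal_natCast, ENNReal.ofReal_pow (by norm_num), ENNReal.ofReal_ofNat]
        push_cast; rfl
    _ ≤ ENNReal.ofReal ε := ENNReal.ofReal_le_ofReal hR

open scoped Classical in
/-- **The success probability of the learner is at least `1 - 1/(2b)`.**
[cite: CarmosinoImpagliazzoKabanetsKolokolova2016, Thm. 5.1 (proof)] -/
theorem card_not_success_le_half {R : CombinatorialProperty} (hD : HasDensity 5 R) (hU : IsUsefulAgainstPPoly R) (k₀ : ℕ)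
    {n a b : ℕ} (ha : 1 ≤ a) (hb : 1 ≤ b) {f : (Fin n → Bool) → Bool} (hf : f ∈ sizeClass B2 (fun n => n ^ k₀) n) :
    ((univ.filter fun rv => ¬ Success n a b f R (goodLvl hU k₀ n a b) rv).card : ℝ) ≤
      1 / (2 * b) * 2 ^ coinLen n a b (goodLvl hU k₀ n a b) := by
  set ℓg := goodLvl hU k₀ n a b with hℓg
  have hadv := hadv_of_goodLevel hD (goodLvl_good hU k₀ n a b) hf
  have hp := card_goodW_ge ha hadv (hGL_holds n a b ℓg) (H1u_holds n a b ℓg ha) (H2u_holds n a b ℓg ha) (H3u_holds n a b ℓg ha)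
  have h := card_not_success_le (f := f) (R := R) ha (fun ℓ => prmM_pos _ ℓ) hp
  have h1 := rep_bound n a b ℓg hb
  have h2 := val_bound n a b ha hb ℓg
  have hb' : (0 : ℝ) < b := by exact_mod_cast hb
  refine h.trans ?_
  have : (1 - pZero n a b ℓg) ^ prmReps (prmS n a b) ℓg +
      ∑ ℓ ∈ Finset.range (ℓg + 1), (prmReps (prmS n a b) ℓ : ℝ) * (2 * Real.exp (-2 * prmM (prmS n a b) ℓ * (1 / (4 * a)) ^ 2)) ≤
      1 / (2 * b) := by
    rw [show (1 : ℝ) / (2 * b) = 1 / (4 * b) + 1 / (4 * b) by field_simp; ring]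
    exact add_le_add h1 h2
  exact mul_le_mul_of_nonneg_right this (by positivity)

/-- **CIKK Theorem 5.1 for the fixed learner**: the PAC guarantee. [cite: CarmosinoImpagliazzoKabanetsKolokolova2016, Thm. 5.1] -/
theorem isPACPredictorFor_cikk {R : CombinatorialProperty} (hD : HasDensity 5 R) (hU : IsUsefulAgainstPPoly R) (k₀ : ℕ) :
    IsPACPredictorFor uniformDistributions true (sizeClass B2 fun n => n ^ k₀) (cikkLearner (propFn R)) (cikkEval (propFn R))
      (cikkCoins hU k₀) (cikkRounds hU k₀) fun _ _ _ => 1 := by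
  classical
  intro n f hf D hDm ε δ hε _hε1 hδ _hδ1
  rw [uniformDistributions, Set.mem_singleton_iff] at hDm
  subst hDm
  set a := invCeil ε with ha
  set b := invCeil δ with hb
  have ha1 : 1 ≤ a := one_le_invCeil hε
  have hb1 : 1 ≤ b := one_le_invCeil hδ
  set ℓg := goodLvl hU k₀ n a b with hℓg
  set C := coinLen n a b ℓg with hC
  have hCdef : cikkCoins hU k₀ n a b = C := rfl
  -- the PAC game as a count over coin strings
  set good : List.Vector Bool C → Bool := fun r =>
    decide (errorProb (PMF.uniformOfFintype (Fin n → Bool)) (evalHyp (cikkEval (propFn R)) 1 (gfnOut R n a b r.toList f)) f ≤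
      ENNReal.ofReal ε) with hgood
  rw [hCdef, pacSuccessProb_eq_card _ true (cikkLearner (propFn R)) (pacParams n a b) (cikkRounds hU k₀ n a b) C f _ ε good
    (fun xs r => by
      rw [runIdx_cikkLearner (dR := propFn R) R (fun y => rfl) a b r.toList (by rw [List.Vector.toList_length]; exact one_le_coinLen n a b ℓg) f xs
        (by rw [cikkRounds, tBudgetOf, hCdef, length_boolPair, List.Vector.toList_length]; exact Nat.lt_succ_self _)])]
  -- success implies a good hypothesis
  have hsub : (univ.filter fun rv : Fin C → Bool => Success n a b f R ℓg rv).card ≤ (univ.filter fun r : List.Vector Bool C => good r = true).card := by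
    rw [← card_filter_univ_equiv (Equiv.vectorEquivFin Bool C) (fun rv : Fin C → Bool => Success n a b f R ℓg rv)]
    refine Finset.card_le_card fun r hr => ?_
    simp only [Finset.mem_filter, Finset.mem_univ, true_and] at hr ⊢
    rw [hgood, decide_eq_true_eq]
    have hl : r.toList = List.ofFn ((Equiv.vectorEquivFin Bool C) r) := by
      rw [show r.toList = (List.Vector.ofFn ((Equiv.vectorEquivFin Bool C) r)).toList by
        rw [Equiv.vectorEquivFin, Equiv.coe_fn_mk, List.Vector.ofFn_get], List.Vector.toList_ofFn]
    rw [hl]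
    exact errorProb_le_of_success hε ha _ (by simpa using hr)
  -- counting
  have hfail : ((univ.filter fun rv : Fin C → Bool => ¬ Success n a b f R ℓg rv).card : ℝ) ≤ 1 / (2 * b) * 2 ^ C :=
    card_not_success_le_half hD hU k₀ ha1 hb1 hf
  have htot : ((univ.filter fun rv : Fin C → Bool => Success n a b f R ℓg rv).card : ℝ) +
      ((univ.filter fun rv : Fin C → Bool => ¬ Success n a b f R ℓg rv).card : ℝ) = 2 ^ C := by
    have := Finset.card_filter_add_card_filter_not (s := (univ : Finset (Fin C → Bool))) (fun rv => Success n a b f R ℓg rv)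
    rw [Finset.card_univ, Fintype.card_fun, Fintype.card_fin, Fintype.card_bool] at this
    exact_mod_cast this
  have hb' : (0 : ℝ) < b := by exact_mod_cast hb1
  have hbδ : 1 / (2 * (b : ℝ)) ≤ δ := by
    have := one_div_invCeil_le hδ
    rw [← hb] at this
    calc 1 / (2 * (b : ℝ)) = (1 / b) / 2 := by field_simp
      _ ≤ δ / 2 := by gcongr
      _ ≤ δ := by linarith
  have hreal : 1 - δ ≤ ((univ.filter fun r : List.Vector Bool C => good r = true).card : ℝ) / 2 ^ C := by
    rw [le_div_iff₀ (by positivity)]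
    have hsubR : ((univ.filter fun rv : Fin C → Bool => Success n a b f R ℓg rv).card : ℝ) ≤
        ((univ.filter fun r : List.Vector Bool C => good r = true).card : ℝ) := by exact_mod_cast hsub
    have h2C : (0 : ℝ) < 2 ^ C := by positivity
    have hδC := mul_le_mul_of_nonneg_right hbδ h2C.le
    linarith [hfail, htot, hsubR, hδC]
  -- to `ℝ≥0∞`
  have h2 : (2 : ENNReal) ^ C = ENNReal.ofReal ((2 : ℝ) ^ C) := by rw [ENNReal.ofReal_pow (by norm_num), ENNReal.ofReal_ofNat]
  rw [h2, ← ENNReal.ofReal_natCast, ← ENNReal.ofReal_div_of_pos (by positivity)]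
  exact ENNReal.ofReal_le_ofReal hreal

/-- **CIKK 2016, Theorem 5.1** (discharge of the named fact `cikk_natural_implies_learning`): natural
proofs of density `1/5`, constructive in `P` and useful against `P/poly`, imply randomized
polynomial-time membership-query learning of `SIZE[n^k]` under the uniform distribution with
subexponential budgets, for every `k`. [cite: CarmosinoImpagliazzoKabanetsKolokolova2016, Thm. 5.1] -/
theorem cikk_natural_implies_learning_holds : cikk_natural_implies_learning := by
  intro R hC hD hU k₀
  exact ⟨cikkLearner (propFn R), cikkEval (propFn R), cikkCoins hU k₀, cikkRounds hU k₀, fun _ _ _ => 1,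
    isPolyTime_cikkLearner (propFn_mem_FP hC), isPolyTime_cikkEval (propFn_mem_FP hC),
    isSubexpBudget_cikkCoins hU k₀, isSubexpBudget_cikkRounds hU k₀, isSubexpBudget_one, isPACPredictorFor_cikk hD hU k₀⟩

end Literature.Computability.Learning
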